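import Literature.Geometry.Riemannian.BaerHankeGluing
import Literature.Geometry.Riemannian.BaerHankeNormalForm
import Literature.Geometry.Lorentzian.MeanCurvatureRegularity
import Literature.Topology.FourManifolds.Gluing
import Mathlib.Geometry.Manifold.PartitionOfUnity
import Summits.SmoothPoincare4.SmoothPoincare4.Theorems.WeylBudgetCorkRegluablePscStubCollarGluing
import HarnessLib

/-!
# Stub `stub_symmetricGluingOfBHData` of line `birth` for the crux `CorkRegluablePsc` — conditional form
(item stmt-SmoothPoincare4-3206, route `WeylBudget`; `--supports` helper, does not close the item)

τ-symmetric gluing of simultaneous Bär–Hanke data: from PSC metrics `g_C`, `g_W` on the cork `C`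
and its complement `W` whose boundary forms agree under `φ` and `φ ∘ τ` and whose outward mean
curvatures satisfy `H_C + H_W ∘ φ ≥ 0`, `H_C + H_W ∘ φ ∘ τ ≥ 0`, build SOME closed `P = C ∪_φ W`
with a PSC metric and an isometric involution `T ⊇ τ` near the seam.  Printed proof: Bär–Hanke
2023, §3: Prop. 28 (strict corner inequalities), Thm. 27 with umbilic `k = λ h` and a common `C₀`
(both metrics become `dt² + (1 - 2λt - C₀t²) h` on their normal collars), glue the collars back
to back (`dr² + (1 + 2λ(y) r - C₀ r²) h_y`), `T := τ × id`.

The registered stub (skeleton `Cruxes/CorkRegluablePsc/Lines/birth.lean`) is landed here in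
CONDITIONAL form, `stub_symmetricGluingOfBHData_of_facts`: the registered signature VERBATIM, GIVEN
* `h28 : Literature.Geometry.Riemannian.BarHanke2023_prop28_meanCurvatureIncrease` and
  `h27 : Literature.Geometry.Riemannian.BarHanke2023_thm27_umbilicNormalForm` — the two Bär–Hanke
  named facts of the tree (`Literature/Geometry/Riemannian/BaerHankeNormalForm.lean`, undischarged
  deformation theory: the trust base of this file);
* `hglue` — the COLLAR GLUING LEMMA (the line's construction stub `stub_collarGluing`, stated
  verbatim as a hypothesis): two Riemannian PSC metrics in umbilic `C₀`-normal form on collars of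
  `∂C`, `∂W` with `τ`-invariant boundary form and warping function glue to `(P, jC, jW, g, U, T)`
  as in the stub's conclusion.
Everything else is PROVED here: the λ-selection step (a smooth `τ`-invariant function strictly
between continuous `τ`-invariant bounds, `exists_contMDiff_invariant_between`, Mathlib partitions
of unity + `τ`-averaging), the continuity of the mean curvatures (the tree's PROVED
`PseudoRiemannianMetric.contMDiff_meanCurvature`), the common constant and collar width, and the
bookkeeping of boundary forms (chain rule `pullbackBilin_comp`).  No theorem named
`stub_symmetricGluingOfBHData` is declared (the hypothesis-free signature is not proved).
No `sorry`; axioms standard.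

References: [BarHanke2023] §3, Def. 21, Thm. 27, Prop. 28 (arXiv:2012.09127 pp. 10–14);
[HirschDT1976] Ch. 8 §2 (gluing along collars); [ONeill1983] Ch. 4 (shape tensor, mean curvature).
-/

noncomputable section

-- `Summit.<Summit>.<Problem>`: for the single-conjunct summit the duplicate component is mandated.
set_option linter.dupNamespace false

open scoped Manifold ContDiff Topology
open Set Function

namespace Summit.SmoothPoincare4.SmoothPoincare4.Theorems

open Literature.Topology.FourManifolds Literature.Geometry.Lorentzian
  Literature.Geometry.Riemannian

/-! ### The λ-selection step -/

/-- **Smooth invariant selection between continuous invariant bounds.** On a compact Hausdorff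
smooth manifold with an involutive diffeomorphism `τ`, if `L < U` are continuous `τ`-invariant
functions then there is a smooth `τ`-invariant `μ` with `L < μ < U` (smooth selection in the convex
sets `(L y, U y)` by partitions of unity, Mathlib's
`exists_contMDiffMap_forall_mem_convex_of_local_const`, then the average `½(μ̃ + μ̃ ∘ τ)`).
[folklore] -/
theorem exists_contMDiff_invariant_between {k : ℕ} {Y : Type*} [TopologicalSpace Y]
    [ChartedSpace (EuclideanSpace ℝ (Fin k)) Y] [IsManifold (𝓡 k) ∞ Y] [T2Space Y] [CompactSpace Y]
    (τ : Y ≃ₘ⟮𝓡 k, 𝓡 k⟯ Y) (hτ : Function.Involutive τ) {L U : Y → ℝ} (hL : Continuous L)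
    (hU : Continuous U) (hLU : ∀ y, L y < U y) (hLτ : ∀ y, L (τ y) = L y)
    (hUτ : ∀ y, U (τ y) = U y) :
    ∃ μ : Y → ℝ, ContMDiff (𝓡 k) 𝓘(ℝ, ℝ) ∞ μ ∧ (∀ y, μ (τ y) = μ y) ∧
      ∀ y, L y < μ y ∧ μ y < U y := by
  obtain ⟨g, hg⟩ := exists_contMDiffMap_forall_mem_convex_of_local_const (𝓡 k) (n := ⊤)
    (t := fun y ↦ Ioo (L y) (U y)) (fun y ↦ convex_Ioo _ _) (fun x ↦ by
      refine ⟨(L x + U x) / 2, ?_⟩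
      have h1 : ∀ᶠ y in 𝓝 x, L y < (L x + U x) / 2 :=
        hL.continuousAt.eventually_lt continuousAt_const (by linarith [hLU x])
      have h2 : ∀ᶠ y in 𝓝 x, (L x + U x) / 2 < U y :=
        continuousAt_const.eventually_lt hU.continuousAt (by linarith [hLU x])
      filter_upwards [h1, h2] with y hy1 hy2 using ⟨hy1, hy2⟩)
  refine ⟨fun y ↦ (g y + g (τ y)) / 2, ?_, fun y ↦ ?_, fun y ↦ ?_⟩
  · have hgs : ContMDiff (𝓡 k) 𝓘(ℝ, ℝ) ∞ g := g.contMDiff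
    exact ((hgs.add (hgs.comp τ.contMDiff)).div_const 2)
  · simp only [hτ y, add_comm]
  · have h1 := hg y
    have h2 := hg (τ y)
    simp only [mem_Ioo, hLτ, hUτ] at h1 h2
    constructor <;> linarith [h1.1, h1.2, h2.1, h2.2]

/-! ### Step 1: Bär–Hanke Prop. 28 on both pieces and the λ-selection -/

/-- **Strict corner inequalities and the warping functions.** Prop. 28 (`h28`, `m = 2`) on
`(C, gC, νC)` and `(W, gW, νW)` gives `gC'`, `gW'` with the same boundary forms, the same unit
normals and `H' = H + δ`, so both corner inequalities become strict; `H(gC')`, `H(gW')` are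
continuous (`PseudoRiemannianMetric.contMDiff_meanCurvature`); `U := min(H_C', H_C' ∘ τ)/3`,
`L := max(-H_W' ∘ φ, -H_W' ∘ φ ∘ τ)/3` are continuous, `τ`-invariant (`τ² = id`) and `L < U`, so
`exists_contMDiff_invariant_between` gives a smooth `τ`-invariant `μ_C` with `L < μ_C < U`, whence
`3 μ_C ≤ H_C'` and, for `μ_W := -μ_C ∘ φ⁻¹`, `3 μ_W ≤ H_W'`. [cite: BarHanke2023, §3 Prop. 28] -/
theorem strictBHData_of_prop28 (h28 : BarHanke2023_prop28_meanCurvatureIncrease)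
    {C : Type} [TopologicalSpace C] [T2Space C] [SecondCountableTopology C] [CompactSpace C]
    [ChartedSpace (EuclideanHalfSpace 4) C] [IsManifold (𝓡∂ 4) ∞ C] (bC : BoundaryData (𝓡∂ 4) C (𝓡 3))
    {W : Type} [TopologicalSpace W] [T2Space W] [SecondCountableTopology W] [CompactSpace W]
    [ChartedSpace (EuclideanHalfSpace 4) W] [IsManifold (𝓡∂ 4) ∞ W] (bW : BoundaryData (𝓡∂ 4) W (𝓡 3))
    (φ : bC.carrier ≃ₘ⟮𝓡 3, 𝓡 3⟯ bW.carrier) (τ : bC.carrier ≃ₘ⟮𝓡 3, 𝓡 3⟯ bC.carrier)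
    (hτ : Function.Involutive τ)
    (gC : PseudoRiemannianMetric (𝓡∂ 4) ∞ (EuclideanSpace ℝ (Fin 4)) (TangentSpace (𝓡∂ 4) : C → Type _))
    [gC.HasLeviCivita] (hfC : gC.IsSpacelikeImmersion (𝓡 3) bC.incl) (νC : NormalField (𝓡∂ 4) bC.incl)
    (gW : PseudoRiemannianMetric (𝓡∂ 4) ∞ (EuclideanSpace ℝ (Fin 4)) (TangentSpace (𝓡∂ 4) : W → Type _))
    [gW.HasLeviCivita] (hfW : gW.IsSpacelikeImmersion (𝓡 3) bW.incl) (νW : NormalField (𝓡∂ 4) bW.incl)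
    (hRC : gC.IsRiemannian) (hSC : ∀ x, 0 < gC.scalarCurvature x) (hUC : gC.IsUnitNormal (𝓡 3) bC.incl νC 1)
    (hνC : ContMDiff (𝓡 3) (𝓡∂ 4).tangent ∞ (fun z ↦
      (Bundle.TotalSpace.mk' (EuclideanSpace ℝ (Fin 4)) (bC.incl z) (νC z) : TangentBundle (𝓡∂ 4) C)))
    (hoC : ∀ z, (show EuclideanSpace ℝ (Fin 4) from νC z) 0 < 0)
    (hRW : gW.IsRiemannian) (hSW : ∀ x, 0 < gW.scalarCurvature x) (hUW : gW.IsUnitNormal (𝓡 3) bW.incl νW 1)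
    (hνW : ContMDiff (𝓡 3) (𝓡∂ 4).tangent ∞ (fun w ↦
      (Bundle.TotalSpace.mk' (EuclideanSpace ℝ (Fin 4)) (bW.incl w) (νW w) : TangentBundle (𝓡∂ 4) W)))
    (hoW : ∀ w, (show EuclideanSpace ℝ (Fin 4) from νW w) 0 < 0)
    (hH : ∀ z, 0 ≤ gC.meanCurvature bC.incl PseudoRiemannianMetric.contMDiff_pullbackBilin_holds hfC νC z +
      gW.meanCurvature bW.incl PseudoRiemannianMetric.contMDiff_pullbackBilin_holds hfW νW (φ z))
    (hHτ : ∀ z, 0 ≤ gC.meanCurvature bC.incl PseudoRiemannianMetric.contMDiff_pullbackBilin_holds hfC νC z +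
      gW.meanCurvature bW.incl PseudoRiemannianMetric.contMDiff_pullbackBilin_holds hfW νW (φ (τ z))) :
    ∃ (gC' : PseudoRiemannianMetric (𝓡∂ 4) ∞ (EuclideanSpace ℝ (Fin 4)) (TangentSpace (𝓡∂ 4) : C → Type _))
      (_ : gC'.HasLeviCivita) (hfC' : gC'.IsSpacelikeImmersion (𝓡 3) bC.incl)
      (gW' : PseudoRiemannianMetric (𝓡∂ 4) ∞ (EuclideanSpace ℝ (Fin 4)) (TangentSpace (𝓡∂ 4) : W → Type _))
      (_ : gW'.HasLeviCivita) (hfW' : gW'.IsSpacelikeImmersion (𝓡 3) bW.incl)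
      (μC : bC.carrier → ℝ) (μW : bW.carrier → ℝ),
      gC'.IsRiemannian ∧ (∀ x, 0 < gC'.scalarCurvature x) ∧ gC'.IsUnitNormal (𝓡 3) bC.incl νC 1 ∧
      (∀ z, pullbackBilin (I := 𝓡∂ 4) (I' := 𝓡 3) bC.incl gC'.val z =
        pullbackBilin (I := 𝓡∂ 4) (I' := 𝓡 3) bC.incl gC.val z) ∧
      gW'.IsRiemannian ∧ (∀ x, 0 < gW'.scalarCurvature x) ∧ gW'.IsUnitNormal (𝓡 3) bW.incl νW 1 ∧
      (∀ w, pullbackBilin (I := 𝓡∂ 4) (I' := 𝓡 3) bW.incl gW'.val w =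
        pullbackBilin (I := 𝓡∂ 4) (I' := 𝓡 3) bW.incl gW.val w) ∧
      ContMDiff (𝓡 3) 𝓘(ℝ, ℝ) ∞ μC ∧ (∀ z, μC (τ z) = μC z) ∧
      ContMDiff (𝓡 3) 𝓘(ℝ, ℝ) ∞ μW ∧ (∀ z, μW (φ z) = -μC z) ∧
      (∀ z, (((2 : ℕ) : ℝ) + 1) * μC z ≤
        gC'.meanCurvature bC.incl PseudoRiemannianMetric.contMDiff_pullbackBilin_holds hfC' νC z) ∧
      (∀ w, (((2 : ℕ) : ℝ) + 1) * μW w ≤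
        gW'.meanCurvature bW.incl PseudoRiemannianMetric.contMDiff_pullbackBilin_holds hfW' νW w) := by
  -- Bär–Hanke Prop. 28 on both pieces: strict corner inequalities
  obtain ⟨δC, hδC, gC', hLC', hfC', hRC', hSC', hUC', hbdC, hHC⟩ :=
    h28 2 C bC gC hfC νC hRC hSC hUC hνC hoC
  obtain ⟨δW, hδW, gW', hLW', hfW', hRW', hSW', hUW', hbdW, hHW⟩ :=
    h28 2 W bW gW hfW νW hRW hSW hUW hνW hoW
  set HC : bC.carrier → ℝ := fun z ↦
    gC'.meanCurvature bC.incl PseudoRiemannianMetric.contMDiff_pullbackBilin_holds hfC' νC z with hHCdef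
  set HW : bW.carrier → ℝ := fun w ↦
    gW'.meanCurvature bW.incl PseudoRiemannianMetric.contMDiff_pullbackBilin_holds hfW' νW w with hHWdef
  -- continuity of the mean curvatures: the tree's `contMDiff_meanCurvature` (O'Neill 1983, Ch. 4)
  have hcC : Continuous HC :=
    (gC'.contMDiff_meanCurvature PseudoRiemannianMetric.contMDiff_pullbackBilin_holds hfC' νC
      hνC).continuous
  have hcW : Continuous HW :=
    (gW'.contMDiff_meanCurvature PseudoRiemannianMetric.contMDiff_pullbackBilin_holds hfW' νW
      hνW).continuous
  have hpos1 : ∀ z, 0 < HC z + HW (φ z) := fun z ↦ by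
    simp only [hHCdef, hHWdef, hHC, hHW]; linarith [hH z]
  have hpos2 : ∀ z, 0 < HC z + HW (φ (τ z)) := fun z ↦ by
    simp only [hHCdef, hHWdef, hHC, hHW]; linarith [hHτ z]
  -- the boundary `∂C` is a compact Hausdorff 3-manifold
  haveI : T2Space bC.carrier := bC.isSmoothEmbedding.isEmbedding.t2Space
  haveI : CompactSpace bC.carrier := by
    refine (Topology.IsClosedEmbedding.mk bC.isSmoothEmbedding.isEmbedding ?_).compactSpace
    rw [bC.range_incl]
    exact ModelWithCorners.isClosed_boundary (I := 𝓡∂ 4) (M := C) (n := ∞) (by simp)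
  -- λ-selection: smooth τ-invariant `μ` with `L < μ < U`
  have hφc : Continuous φ := φ.continuous
  have hτc : Continuous τ := τ.continuous
  set Lf : bC.carrier → ℝ := fun z ↦ max (-(HW (φ z))) (-(HW (φ (τ z)))) / 3 with hLfdef
  set Uf : bC.carrier → ℝ := fun z ↦ min (HC z) (HC (τ z)) / 3 with hUfdef
  have hLc : Continuous Lf :=
    ((hcW.comp hφc).neg.max (hcW.comp (hφc.comp hτc)).neg).div_const 3
  have hUc : Continuous Uf := (hcC.min (hcC.comp hτc)).div_const 3
  have hLU : ∀ z, Lf z < Uf z := by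
    intro z
    have a1 := hpos1 z
    have a2 := hpos2 z
    have a3 := hpos1 (τ z)
    have a4 := hpos2 (τ z)
    rw [hτ z] at a4
    simp only [hLfdef, hUfdef]
    rw [div_lt_div_iff_of_pos_right (by norm_num : (0:ℝ) < 3), max_lt_iff, lt_min_iff, lt_min_iff]
    exact ⟨⟨by linarith, by linarith⟩, ⟨by linarith, by linarith⟩⟩
  have hLτ : ∀ z, Lf (τ z) = Lf z := fun z ↦ by
    simp only [hLfdef]; rw [hτ z, max_comm]
  have hUτ : ∀ z, Uf (τ z) = Uf z := fun z ↦ by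
    simp only [hUfdef]; rw [hτ z, min_comm]
  obtain ⟨μ, hμs, hμτ, hμb⟩ := exists_contMDiff_invariant_between τ hτ hLc hUc hLU hLτ hUτ
  have hμC : ∀ z, (((2 : ℕ) : ℝ) + 1) * μ z ≤
      gC'.meanCurvature bC.incl PseudoRiemannianMetric.contMDiff_pullbackBilin_holds hfC' νC z := by
    intro z
    have h1 := (hμb z).2
    have h2 : min (HC z) (HC (τ z)) ≤ HC z := min_le_left _ _
    simp only [hUfdef] at h1
    show ((2 : ℕ) + 1 : ℝ) * μ z ≤ HC z
    push_cast
    linarith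
  -- `μ_W := -μ ∘ φ⁻¹`, introduced as an opaque function with its defining equation
  obtain ⟨μW, hμWdef⟩ : ∃ f : bW.carrier → ℝ, ∀ w, f w = -μ (φ.symm w) := ⟨_, fun w ↦ rfl⟩
  have hμWs : ContMDiff (𝓡 3) 𝓘(ℝ, ℝ) ∞ μW := by
    rw [show μW = fun w ↦ -μ (φ.symm w) from funext hμWdef]
    exact (hμs.comp φ.symm.contMDiff).neg
  have hμWφ : ∀ z, μW (φ z) = -μ z := fun z ↦ by
    rw [hμWdef, Diffeomorph.symm_apply_apply]
  have hμW : ∀ w, (((2 : ℕ) : ℝ) + 1) * μW w ≤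
      gW'.meanCurvature bW.incl PseudoRiemannianMetric.contMDiff_pullbackBilin_holds hfW' νW w := by
    intro w
    rw [hμWdef w]
    have h1 := (hμb (φ.symm w)).1
    have h2 : -(HW (φ (φ.symm w))) ≤ max (-(HW (φ (φ.symm w)))) (-(HW (φ (τ (φ.symm w))))) :=
      le_max_left _ _
    rw [Diffeomorph.apply_symm_apply] at h2
    simp only [hLfdef, Diffeomorph.apply_symm_apply] at h1
    show ((2 : ℕ) + 1 : ℝ) * (-μ (φ.symm w)) ≤ HW w
    push_cast
    linarith
  exact ⟨gC', hLC', hfC', gW', hLW', hfW', μ, μW, hRC', hSC', hUC', hbdC, hRW', hSW', hUW', hbdW,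
    hμs, hμτ, hμWs, hμWφ, hμC, hμW⟩

/-! ### Step 2: Bär–Hanke Thm. 27 on both pieces, common constant and common collar width -/

/-- **Umbilic `C₀`-normal collars on both pieces.** Thm. 27 (`h27`, `m = 2`) on `(C, gC, μ_C)` and
on `(W, gW, μ_W)` (`3 μ ≤ H`), with the common constant `max C₀ C₀'` and the common width
`ε := min ε₀ ε₀'`, gives PSC metrics `ĝC`, `ĝW` with unchanged boundary forms and collars `cC`,
`cW` on which they are `ε² ds² + (1 - 2 μ ε s - C₀ ε² s²) · incl^* ĝ` (the normal forms of the
fact, rewritten over the new metrics' own boundary forms). [cite: BarHanke2023, §3 Thm. 27] -/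
theorem umbilicCollars_of_thm27 (h27 : BarHanke2023_thm27_umbilicNormalForm)
    {C : Type} [TopologicalSpace C] [T2Space C] [SecondCountableTopology C] [CompactSpace C]
    [ChartedSpace (EuclideanHalfSpace 4) C] [IsManifold (𝓡∂ 4) ∞ C] (bC : BoundaryData (𝓡∂ 4) C (𝓡 3))
    {W : Type} [TopologicalSpace W] [T2Space W] [SecondCountableTopology W] [CompactSpace W]
    [ChartedSpace (EuclideanHalfSpace 4) W] [IsManifold (𝓡∂ 4) ∞ W] (bW : BoundaryData (𝓡∂ 4) W (𝓡 3))
    (gC : PseudoRiemannianMetric (𝓡∂ 4) ∞ (EuclideanSpace ℝ (Fin 4)) (TangentSpace (𝓡∂ 4) : C → Type _))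
    [gC.HasLeviCivita] (hfC : gC.IsSpacelikeImmersion (𝓡 3) bC.incl) (νC : NormalField (𝓡∂ 4) bC.incl)
    (gW : PseudoRiemannianMetric (𝓡∂ 4) ∞ (EuclideanSpace ℝ (Fin 4)) (TangentSpace (𝓡∂ 4) : W → Type _))
    [gW.HasLeviCivita] (hfW : gW.IsSpacelikeImmersion (𝓡 3) bW.incl) (νW : NormalField (𝓡∂ 4) bW.incl)
    (μC : bC.carrier → ℝ) (μW : bW.carrier → ℝ)
    (hRC : gC.IsRiemannian) (hSC : ∀ x, 0 < gC.scalarCurvature x) (hUC : gC.IsUnitNormal (𝓡 3) bC.incl νC 1)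
    (hνC : ContMDiff (𝓡 3) (𝓡∂ 4).tangent ∞ (fun z ↦
      (Bundle.TotalSpace.mk' (EuclideanSpace ℝ (Fin 4)) (bC.incl z) (νC z) : TangentBundle (𝓡∂ 4) C)))
    (hoC : ∀ z, (show EuclideanSpace ℝ (Fin 4) from νC z) 0 < 0)
    (hRW : gW.IsRiemannian) (hSW : ∀ x, 0 < gW.scalarCurvature x) (hUW : gW.IsUnitNormal (𝓡 3) bW.incl νW 1)
    (hνW : ContMDiff (𝓡 3) (𝓡∂ 4).tangent ∞ (fun w ↦
      (Bundle.TotalSpace.mk' (EuclideanSpace ℝ (Fin 4)) (bW.incl w) (νW w) : TangentBundle (𝓡∂ 4) W)))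
    (hoW : ∀ w, (show EuclideanSpace ℝ (Fin 4) from νW w) 0 < 0)
    (hμCs : ContMDiff (𝓡 3) 𝓘(ℝ, ℝ) ∞ μC) (hμWs : ContMDiff (𝓡 3) 𝓘(ℝ, ℝ) ∞ μW)
    (hμC : ∀ z, (((2 : ℕ) : ℝ) + 1) * μC z ≤
      gC.meanCurvature bC.incl PseudoRiemannianMetric.contMDiff_pullbackBilin_holds hfC νC z)
    (hμW : ∀ w, (((2 : ℕ) : ℝ) + 1) * μW w ≤
      gW.meanCurvature bW.incl PseudoRiemannianMetric.contMDiff_pullbackBilin_holds hfW νW w) :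
    ∃ (ĝC : PseudoRiemannianMetric (𝓡∂ 4) ∞ (EuclideanSpace ℝ (Fin 4)) (TangentSpace (𝓡∂ 4) : C → Type _))
      (_ : ĝC.HasLeviCivita)
      (ĝW : PseudoRiemannianMetric (𝓡∂ 4) ∞ (EuclideanSpace ℝ (Fin 4)) (TangentSpace (𝓡∂ 4) : W → Type _))
      (_ : ĝW.HasLeviCivita) (C₀ ε : ℝ) (cC : bC.Collar) (cW : bW.Collar),
      ĝC.IsRiemannian ∧ (∀ x, 0 < ĝC.scalarCurvature x) ∧
      ĝW.IsRiemannian ∧ (∀ x, 0 < ĝW.scalarCurvature x) ∧ 0 < ε ∧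
      (∀ z, pullbackBilin (I := 𝓡∂ 4) (I' := 𝓡 3) bC.incl ĝC.val z =
        pullbackBilin (I := 𝓡∂ 4) (I' := 𝓡 3) bC.incl gC.val z) ∧
      (∀ w, pullbackBilin (I := 𝓡∂ 4) (I' := 𝓡 3) bW.incl ĝW.val w =
        pullbackBilin (I := 𝓡∂ 4) (I' := 𝓡 3) bW.incl gW.val w) ∧
      (∀ (p : bC.carrier × Set.Icc (0 : ℝ) 1) (V V' : TangentSpace ((𝓡 3).prod (𝓡∂ 1)) p),
        pullbackBilin (I := 𝓡∂ 4) (I' := (𝓡 3).prod (𝓡∂ 1)) cC ĝC.val p V V' =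
          ε ^ 2 * ((show EuclideanSpace ℝ (Fin 1) from V.2) 0 *
            (show EuclideanSpace ℝ (Fin 1) from V'.2) 0) +
          (1 - 2 * μC p.1 * (ε * (p.2 : ℝ)) - C₀ * (ε * (p.2 : ℝ)) ^ 2) *
            pullbackBilin (I := 𝓡∂ 4) (I' := 𝓡 3) bC.incl ĝC.val p.1 V.1 V'.1) ∧
      (∀ (q : bW.carrier × Set.Icc (0 : ℝ) 1) (V V' : TangentSpace ((𝓡 3).prod (𝓡∂ 1)) q),
        pullbackBilin (I := 𝓡∂ 4) (I' := (𝓡 3).prod (𝓡∂ 1)) cW ĝW.val q V V' =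
          ε ^ 2 * ((show EuclideanSpace ℝ (Fin 1) from V.2) 0 *
            (show EuclideanSpace ℝ (Fin 1) from V'.2) 0) +
          (1 - 2 * μW q.1 * (ε * (q.2 : ℝ)) - C₀ * (ε * (q.2 : ℝ)) ^ 2) *
            pullbackBilin (I := 𝓡∂ 4) (I' := 𝓡 3) bW.incl ĝW.val q.1 V.1 V'.1) := by
  obtain ⟨K₁, hK₁, h27C⟩ := h27 2 C bC gC hfC νC μC hRC hSC hUC hνC hoC hμCs hμC
  obtain ⟨K₂, hK₂, h27W⟩ := h27 2 W bW gW hfW νW μW hRW hSW hUW hνW hoW hμWs hμW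
  obtain ⟨gC'', hLC'', ε₁, hRC'', hSC'', hbdC', hε₁, hcolC⟩ := h27C (max K₁ K₂) (le_max_left _ _)
  obtain ⟨gW'', hLW'', ε₂, hRW'', hSW'', hbdW', hε₂, hcolW⟩ := h27W (max K₁ K₂) (le_max_right _ _)
  have hε : 0 < min ε₁ ε₂ := lt_min hε₁ hε₂
  -- (eliminate the collar existentials directly; plain `obtain` is markedly slower here)
  refine (hcolC (min ε₁ ε₂) hε (min_le_left _ _)).elim fun cC hcC' ↦ ?_
  refine (hcolW (min ε₁ ε₂) hε (min_le_right _ _)).elim fun cW hcW' ↦ ?_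
  refine ⟨gC'', hLC'', gW'', hLW'', max K₁ K₂, min ε₁ ε₂, cC, cW, hRC'', hSC'', hRW'', hSW'', hε,
    hbdC', hbdW', fun p V V' ↦ ?_, fun q V V' ↦ ?_⟩
  -- the normal forms, rewritten over the new metrics' own boundary forms
  · rw [hcC' p V V', hbdC' p.1]
  · rw [hcW' q V V', hbdW' q.1]

/-! ### The conditional stub -/

/-- **Stub `stub_symmetricGluingOfBHData`, conditional form** (the registered signature of line
`birth` of the crux `CorkRegluablePsc`, VERBATIM, GIVEN the two Bär–Hanke named facts and the
collar gluing lemma).  From `h28` (Bär–Hanke Prop. 28), `h27` (Bär–Hanke Thm. 27, umbilic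
`C`-normal form on a collar) and `hglue` (the collar gluing lemma: two Riemannian PSC metrics on
`C`, `W` which on collars `cC`, `cW` of width parameter `ε` are the umbilic `C₀`-normal warped
products `ε² ds² + (1 - 2 μ_C(z) ε s - C₀ ε² s²) h_C`, `ε² ds² + (1 - 2 μ_W(w) ε s - C₀ ε² s²) h_W`
with `μ_C` smooth and `τ`-invariant, `μ_W ∘ φ = -μ_C`, `τ^* h_C = h_C`, `h_C = φ^* h_W`, glue on
SOME closed smooth `P = C ∪_φ W` to a PSC metric with an isometric side-preserving involution
`T ⊇ τ` near the seam): simultaneous Bär–Hanke data `(gC, νC)`, `(gW, νW)` on an involutive cork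
presentation (matching boundary forms under `φ` and `φ ∘ τ`, `H_C + H_W ∘ φ ≥ 0`,
`H_C + H_W ∘ φ ∘ τ ≥ 0`) glue to such a `(P, jC, jW, g, U, T)`.
Proof: `strictBHData_of_prop28` (Prop. 28 twice, continuity of `H`, λ-selection), then
`umbilicCollars_of_thm27` (Thm. 27 twice, common constant and width); the boundary forms never
change, so `τ^* h = h` and `h = φ^* h_W` for the new metrics follow from the matching hypotheses
by the chain rule (`pullbackBilin_comp`); conclude by `hglue`.
[cite: BarHanke2023, §3 Thm. 27 and Prop. 28 with Def. 21] -/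
theorem stub_symmetricGluingOfBHData_of_facts :
    Literature.Geometry.Riemannian.BarHanke2023_prop28_meanCurvatureIncrease →
    Literature.Geometry.Riemannian.BarHanke2023_thm27_umbilicNormalForm →
    (∀ (C : Type) [TopologicalSpace C] [T2Space C] [SecondCountableTopology C] [ChartedSpace (EuclideanHalfSpace 4) C] [IsManifold (𝓡∂ 4) ∞ C] [CompactSpace C] (bC : Literature.Topology.FourManifolds.BoundaryData (𝓡∂ 4) C (𝓡 3)) (W : Type) [TopologicalSpace W] [T2Space W] [SecondCountableTopology W] [ChartedSpace (EuclideanHalfSpace 4) W] [IsManifold (𝓡∂ 4) ∞ W] [CompactSpace W] (bW : Literature.Topology.FourManifolds.BoundaryData (𝓡∂ 4) W (𝓡 3)) (φ : bC.carrier ≃ₘ⟮𝓡 3, 𝓡 3⟯ bW.carrier) (τ : bC.carrier ≃ₘ⟮𝓡 3, 𝓡 3⟯ bC.carrier), Function.Involutive τ → ∀ (gC : Literature.Geometry.Lorentzian.PseudoRiemannianMetric (𝓡∂ 4) ∞ (EuclideanSpace ℝ (Fin 4)) (TangentSpace (𝓡∂ 4) : C → Type _)) [gC.HasLeviCivita]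 (gW : Literature.Geometry.Lorentzian.PseudoRiemannianMetric (𝓡∂ 4) ∞ (EuclideanSpace ℝ (Fin 4)) (TangentSpace (𝓡∂ 4) : W → Type _)) [gW.HasLeviCivita] (μC : bC.carrier → ℝ) (μW : bW.carrier → ℝ) (C₀ ε : ℝ) (cC : bC.Collar) (cW : bW.Collar), gC.IsRiemannian → (∀ x, 0 < gC.scalarCurvature x) → gW.IsRiemannian → (∀ x, 0 < gW.scalarCurvature x) → 0 < ε → ContMDiff (𝓡 3) 𝓘(ℝ, ℝ) ∞ μC → (∀ z, μC (τ z) = μC z) → (∀ z, μW (φ z) = -μC z) → (∀ z, Literature.Geometry.Lorentzian.pullbackBilin (I := 𝓡∂ 4) (I' := 𝓡 3) (bC.incl ∘ τ) gC.val z = Literature.Geometry.Lorentzian.pullbackBilin (I := 𝓡∂ 4) (I' := 𝓡 3) bC.incl gC.val z) → (∀ z, Literature.Geometry.Lorentzian.pullbackBilin (I := 𝓡∂ 4) (I' := 𝓡 3) bC.incl gC.val z = Literature.Geometry.Lorentzian.pullbackBilin (I := 𝓡∂ 4) (I' := 𝓡 3) (bW.incl ∘ φ) gW.val z) → (∀ (p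 : bC.carrier × Set.Icc (0 : ℝ) 1) (V V' : TangentSpace ((𝓡 3).prod (𝓡∂ 1)) p), Literature.Geometry.Lorentzian.pullbackBilin (I := 𝓡∂ 4) (I' := (𝓡 3).prod (𝓡∂ 1)) cC gC.val p V V' = ε ^ 2 * ((show EuclideanSpace ℝ (Fin 1) from V.2) 0 * (show EuclideanSpace ℝ (Fin 1) from V'.2) 0) + (1 - 2 * μC p.1 * (ε * (p.2 : ℝ)) - C₀ * (ε * (p.2 : ℝ)) ^ 2) * Literature.Geometry.Lorentzian.pullbackBilin (I := 𝓡∂ 4) (I' := 𝓡 3) bC.incl gC.val p.1 V.1 V'.1) → (∀ (q : bW.carrier × Set.Icc (0 : ℝ) 1) (V V' : TangentSpace ((𝓡 3).prod (𝓡∂ 1)) q), Literature.Geometry.Lorentzian.pullbackBilin (I := 𝓡∂ 4) (I' := (𝓡 3).prod (𝓡∂ 1)) cW gW.val q V V' = ε ^ 2 * ((show EuclideanSpace ℝ (Fin 1) from V.2) 0 * (show EuclideanSpace ℝ (Fin 1) from V'.2) 0) + (1 - 2 * μW q.1 * (ε * (q.2 : ℝ)) - C₀ * (ε * (q.2 :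 ℝ)) ^ 2) * Literature.Geometry.Lorentzian.pullbackBilin (I := 𝓡∂ 4) (I' := 𝓡 3) bW.incl gW.val q.1 V.1 V'.1) → ∃ (P : Type) (_ : TopologicalSpace P) (_ : T2Space P) (_ : SecondCountableTopology P) (_ : ChartedSpace (EuclideanSpace ℝ (Fin 4)) P) (_ : IsManifold (𝓡 4) ∞ P), ∃ (jC : C → P) (jW : W → P), (Manifold.IsSmoothEmbedding (𝓡∂ 4) (𝓡 4) ∞ jC ∧ Manifold.IsSmoothEmbedding (𝓡∂ 4) (𝓡 4) ∞ jW ∧ Set.range jC ∪ Set.range jW = Set.univ ∧ (∀ a b, jC a = jW b ↔ ∃ z, a = bC.incl z ∧ b = bW.incl (φ z))) ∧ ∃ (g : Literature.Geometry.Lorentzian.PseudoRiemannianMetric (𝓡 4) ∞ (EuclideanSpace ℝ (Fin 4)) (TangentSpace (𝓡 4) : P → Type _)) (U : Set P) (T : P → P), g.IsRiemannian ∧ (∃ _ : g.HasLeviCivita, ∀ x, 0 < g.scalarCurvature x) ∧ IsOpen U ∧ (∀ z, jC (bC.incl z) ∈ U) ∧ ContMDiffOn (𝓡 4) (𝓡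 4) ∞ T U ∧ (∀ x ∈ U, T x ∈ U) ∧ (∀ x ∈ U, T (T x) = x) ∧ (∀ x ∈ U, (T x ∈ Set.range jC ↔ x ∈ Set.range jC)) ∧ (∀ z, T (jC (bC.incl z)) = jC (bC.incl (τ z))) ∧ (∀ x ∈ U, Literature.Geometry.Lorentzian.pullbackBilin (I := 𝓡 4) (I' := 𝓡 4) T g.val x = g.val x)) →
    ∀ (C : Type) [TopologicalSpace C] [T2Space C] [SecondCountableTopology C] [ChartedSpace (EuclideanHalfSpace 4) C] [IsManifold (𝓡∂ 4) ∞ C] [CompactSpace C] [ContractibleSpace C] (bC : Literature.Topology.FourManifolds.BoundaryData (𝓡∂ 4) C (𝓡 3)) (W : Type) [TopologicalSpace W] [T2Space W] [SecondCountableTopology W] [ChartedSpace (EuclideanHalfSpace 4) W] [IsManifold (𝓡∂ 4) ∞ W] [CompactSpace W] (bW : Literature.Topology.FourManifolds.BoundaryData (𝓡∂ 4) W (𝓡 3)) (φ : bC.carrier ≃ₘ⟮𝓡 3, 𝓡 3⟯ bW.carrier) (τ : bC.carrier ≃ₘ⟮𝓡 3, 𝓡 3⟯ bC.carrier), Function.Involutive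 τ → ∀ (gC : Literature.Geometry.Lorentzian.PseudoRiemannianMetric (𝓡∂ 4) ∞ (EuclideanSpace ℝ (Fin 4)) (TangentSpace (𝓡∂ 4) : C → Type _)) [gC.HasLeviCivita] (hfC : gC.IsSpacelikeImmersion (𝓡 3) bC.incl) (νC : Literature.Geometry.Lorentzian.NormalField (𝓡∂ 4) bC.incl) (gW : Literature.Geometry.Lorentzian.PseudoRiemannianMetric (𝓡∂ 4) ∞ (EuclideanSpace ℝ (Fin 4)) (TangentSpace (𝓡∂ 4) : W → Type _)) [gW.HasLeviCivita] (hfW : gW.IsSpacelikeImmersion (𝓡 3) bW.incl) (νW : Literature.Geometry.Lorentzian.NormalField (𝓡∂ 4) bW.incl), (gC.IsRiemannian ∧ (∀ x, 0 < gC.scalarCurvature x) ∧ gC.IsUnitNormal (𝓡 3) bC.incl νC 1 ∧ ContMDiff (𝓡 3) (𝓡∂ 4).tangent ∞ (fun z ↦ (Bundle.TotalSpace.mk' (EuclideanSpace ℝ (Fin 4)) (bC.incl z) (νC z) : TangentBundle (𝓡∂ 4) C)) ∧ (∀ z, (show EuclideanSpace ℝ (Fin 4) from νC z) 0 < 0))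 → (gW.IsRiemannian ∧ (∀ x, 0 < gW.scalarCurvature x) ∧ gW.IsUnitNormal (𝓡 3) bW.incl νW 1 ∧ ContMDiff (𝓡 3) (𝓡∂ 4).tangent ∞ (fun w ↦ (Bundle.TotalSpace.mk' (EuclideanSpace ℝ (Fin 4)) (bW.incl w) (νW w) : TangentBundle (𝓡∂ 4) W)) ∧ (∀ w, (show EuclideanSpace ℝ (Fin 4) from νW w) 0 < 0)) → (∀ z, Literature.Geometry.Lorentzian.pullbackBilin (I := 𝓡∂ 4) (I' := 𝓡 3) bC.incl gC.val z = Literature.Geometry.Lorentzian.pullbackBilin (I := 𝓡∂ 4) (I' := 𝓡 3) (bW.incl ∘ φ) gW.val z) → (∀ z, Literature.Geometry.Lorentzian.pullbackBilin (I := 𝓡∂ 4) (I' := 𝓡 3) bC.incl gC.val z = Literature.Geometry.Lorentzian.pullbackBilin (I := 𝓡∂ 4) (I' := 𝓡 3) (bW.incl ∘ φ ∘ τ) gW.val z) → (∀ z, 0 ≤ gC.meanCurvature bC.incl Literature.Geometry.Lorentzian.PseudoRiemannianMetric.contMDiff_pullbackBilin_holds hfC νC z + gW.meanCurvature bW.incl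 Literature.Geometry.Lorentzian.PseudoRiemannianMetric.contMDiff_pullbackBilin_holds hfW νW (φ z)) → (∀ z, 0 ≤ gC.meanCurvature bC.incl Literature.Geometry.Lorentzian.PseudoRiemannianMetric.contMDiff_pullbackBilin_holds hfC νC z + gW.meanCurvature bW.incl Literature.Geometry.Lorentzian.PseudoRiemannianMetric.contMDiff_pullbackBilin_holds hfW νW (φ (τ z))) → ∃ (P : Type) (_ : TopologicalSpace P) (_ : T2Space P) (_ : SecondCountableTopology P) (_ : ChartedSpace (EuclideanSpace ℝ (Fin 4)) P) (_ : IsManifold (𝓡 4) ∞ P), ∃ (jC : C → P) (jW : W → P), (Manifold.IsSmoothEmbedding (𝓡∂ 4) (𝓡 4) ∞ jC ∧ Manifold.IsSmoothEmbedding (𝓡∂ 4) (𝓡 4) ∞ jW ∧ Set.range jC ∪ Set.range jW = Set.univ ∧ (∀ a b, jC a = jW b ↔ ∃ z, a = bC.incl z ∧ b = bW.incl (φ z))) ∧ ∃ (g : Literature.Geometry.Lorentzian.PseudoRiemannianMetric (𝓡 4) ∞ (EuclideanSpace ℝ (Fin 4)) (TangentSpace (𝓡 4) : P → Type _)) (U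 : Set P) (T : P → P), g.IsRiemannian ∧ (∃ _ : g.HasLeviCivita, ∀ x, 0 < g.scalarCurvature x) ∧ IsOpen U ∧ (∀ z, jC (bC.incl z) ∈ U) ∧ ContMDiffOn (𝓡 4) (𝓡 4) ∞ T U ∧ (∀ x ∈ U, T x ∈ U) ∧ (∀ x ∈ U, T (T x) = x) ∧ (∀ x ∈ U, (T x ∈ Set.range jC ↔ x ∈ Set.range jC)) ∧ (∀ z, T (jC (bC.incl z)) = jC (bC.incl (τ z))) ∧ (∀ x ∈ U, Literature.Geometry.Lorentzian.pullbackBilin (I := 𝓡 4) (I' := 𝓡 4) T g.val x = g.val x) := by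
  intro h28 h27 hglue C _ _ _ _ _ _ _ bC W _ _ _ _ _ _ bW φ τ hτ gC _ hfC νC gW _ hfW νW hC hW hmet hmetτ
    hH hHτ
  obtain ⟨hRC, hSC, hUC, hνC, hoC⟩ := hC
  obtain ⟨hRW, hSW, hUW, hνW, hoW⟩ := hW
  -- Step 1: Prop. 28 on both pieces and the λ-selection
  obtain ⟨gC', iC', hfC', gW', iW', hfW', μC, μW, hRC', hSC', hUC', hbdC, hRW', hSW', hUW', hbdW,
      hμCs, hμCτ, hμWs, hμWφ, hμC, hμW⟩ :=
    strictBHData_of_prop28 h28 bC bW φ τ hτ gC hfC νC gW hfW νW hRC hSC hUC hνC hoC hRW hSW hUW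
      hνW hoW hH hHτ
  -- Step 2: Thm. 27 on both pieces, common constant and common collar width
  obtain ⟨gC'', iC'', gW'', iW'', K, ε, cC, cW, hRC'', hSC'', hRW'', hSW'', hε, hbdC', hbdW',
      hnfC, hnfW⟩ :=
    umbilicCollars_of_thm27 h27 bC bW gC' hfC' νC gW' hfW' νW μC μW hRC' hSC' hUC' hνC hoC hRW'
      hSW' hUW' hνW hoW hμCs hμWs hμC hμW
  -- the boundary forms never changed (`incl^* g'' = incl^* g' = incl^* g`): transfer the
  -- matching conditions to `gC''`, `gW''` by the chain rule
  have hdiC : MDifferentiable (𝓡 3) (𝓡∂ 4) bC.incl :=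
    bC.isSmoothEmbedding.contMDiff.mdifferentiable (by simp)
  have hdiW : MDifferentiable (𝓡 3) (𝓡∂ 4) bW.incl :=
    bW.isSmoothEmbedding.contMDiff.mdifferentiable (by simp)
  have hdτ : MDifferentiable (𝓡 3) (𝓡 3) τ := τ.contMDiff.mdifferentiable (by simp)
  have hdφ : MDifferentiable (𝓡 3) (𝓡 3) φ := φ.contMDiff.mdifferentiable (by simp)
  have e2 : pullbackBilin (I := 𝓡∂ 4) (I' := 𝓡 3) bC.incl gC''.val =
      pullbackBilin (I := 𝓡∂ 4) (I' := 𝓡 3) bC.incl gC.val :=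
    funext fun z ↦ (hbdC' z).trans (hbdC z)
  have e6 : pullbackBilin (I := 𝓡∂ 4) (I' := 𝓡 3) bW.incl gW''.val =
      pullbackBilin (I := 𝓡∂ 4) (I' := 𝓡 3) bW.incl gW.val :=
    funext fun w ↦ (hbdW' w).trans (hbdW w)
  have e4 : pullbackBilin (I := 𝓡∂ 4) (I' := 𝓡 3) (bW.incl ∘ φ) gW.val =
      pullbackBilin (I := 𝓡∂ 4) (I' := 𝓡 3) bC.incl gC.val :=
    funext fun z ↦ (hmet z).symm
  have e1 : pullbackBilin (I := 𝓡∂ 4) (I' := 𝓡 3) (bC.incl ∘ τ) gC''.val =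
      pullbackBilin (I := 𝓡 3) (I' := 𝓡 3) τ (pullbackBilin (I := 𝓡∂ 4) (I' := 𝓡 3) bC.incl gC''.val) :=
    pullbackBilin_comp hdiC hdτ _
  have e3 : pullbackBilin (I := 𝓡∂ 4) (I' := 𝓡 3) (bW.incl ∘ ⇑φ ∘ ⇑τ) gW.val =
      pullbackBilin (I := 𝓡 3) (I' := 𝓡 3) τ (pullbackBilin (I := 𝓡∂ 4) (I' := 𝓡 3) (bW.incl ∘ φ) gW.val) :=
    pullbackBilin_comp (f := τ) (g := bW.incl ∘ φ) (hdiW.comp hdφ) hdτ _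
  have e5 : pullbackBilin (I := 𝓡∂ 4) (I' := 𝓡 3) (bW.incl ∘ φ) gW''.val =
      pullbackBilin (I := 𝓡 3) (I' := 𝓡 3) φ (pullbackBilin (I := 𝓡∂ 4) (I' := 𝓡 3) bW.incl gW''.val) :=
    pullbackBilin_comp hdiW hdφ _
  have e7 : pullbackBilin (I := 𝓡∂ 4) (I' := 𝓡 3) (bW.incl ∘ φ) gW.val =
      pullbackBilin (I := 𝓡 3) (I' := 𝓡 3) φ (pullbackBilin (I := 𝓡∂ 4) (I' := 𝓡 3) bW.incl gW.val) :=
    pullbackBilin_comp hdiW hdφ _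
  have hτinv : ∀ z, pullbackBilin (I := 𝓡∂ 4) (I' := 𝓡 3) (bC.incl ∘ τ) gC''.val z =
      pullbackBilin (I := 𝓡∂ 4) (I' := 𝓡 3) bC.incl gC''.val z := fun z ↦ by
    rw [e1, e2, ← e4, ← e3]
    exact (hmetτ z).symm.trans (hmet z)
  have hmatch : ∀ z, pullbackBilin (I := 𝓡∂ 4) (I' := 𝓡 3) bC.incl gC''.val z =
      pullbackBilin (I := 𝓡∂ 4) (I' := 𝓡 3) (bW.incl ∘ φ) gW''.val z := fun z ↦ by
    rw [e2, e5, e6, ← e7]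
    exact hmet z
  -- Step 3: the collar gluing lemma
  exact hglue C bC W bW φ τ hτ gC'' gW'' μC μW K ε cC cW hRC'' hSC'' hRW'' hSW'' hε hμCs hμCτ hμWφ
    hτinv hmatch hnfC hnfW


/-- **Stub 2B modulo the two Bär–Hanke named facts only.**  With the collar-gluing construction now
LANDED (`Summit.SmoothPoincare4.SmoothPoincare4.Theorems.stub_collarGluing`, p160756), the registered
statement of `stub_symmetricGluingOfBHData` follows from the named facts
`BarHanke2023_prop28_meanCurvatureIncrease` (Bär–Hanke 2023 Prop. 28) and
`BarHanke2023_thm27_umbilicNormalForm` (Bär–Hanke 2023 Thm. 27 with Def. 21) alone.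
CONDITIONAL result (the two facts are unproved literature debts of the tree).
[cite: BarHanke2023, §3 Thm. 27, Prop. 28] -/
theorem stub_symmetricGluingOfBHData_of_bhFacts :
    Literature.Geometry.Riemannian.BarHanke2023_prop28_meanCurvatureIncrease →
    Literature.Geometry.Riemannian.BarHanke2023_thm27_umbilicNormalForm →
    ∀ (C : Type) [TopologicalSpace C] [T2Space C] [SecondCountableTopology C] [ChartedSpace (EuclideanHalfSpace 4) C] [IsManifold (𝓡∂ 4) ∞ C] [CompactSpace C] [ContractibleSpace C] (bC : Literature.Topology.FourManifolds.BoundaryData (𝓡∂ 4) C (𝓡 3)) (W : Type) [TopologicalSpace W] [T2Space W] [SecondCountableTopology W] [ChartedSpace (EuclideanHalfSpace 4) W] [IsManifold (𝓡∂ 4) ∞ W] [CompactSpace W] (bW : Literature.Topology.FourManifolds.BoundaryData (𝓡∂ 4) W (𝓡 3)) (φ : bC.carrier ≃ₘ⟮𝓡 3, 𝓡 3⟯ bW.carrier) (τ : bC.carrier ≃ₘ⟮𝓡 3, 𝓡 3⟯ bC.carrier), Function.Involutive τ → ∀ (gC : Literature.Geometry.Lorentzian.PseudoRiemannianMetric (𝓡∂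 4) ∞ (EuclideanSpace ℝ (Fin 4)) (TangentSpace (𝓡∂ 4) : C → Type _)) [gC.HasLeviCivita] (hfC : gC.IsSpacelikeImmersion (𝓡 3) bC.incl) (νC : Literature.Geometry.Lorentzian.NormalField (𝓡∂ 4) bC.incl) (gW : Literature.Geometry.Lorentzian.PseudoRiemannianMetric (𝓡∂ 4) ∞ (EuclideanSpace ℝ (Fin 4)) (TangentSpace (𝓡∂ 4) : W → Type _)) [gW.HasLeviCivita] (hfW : gW.IsSpacelikeImmersion (𝓡 3) bW.incl) (νW : Literature.Geometry.Lorentzian.NormalField (𝓡∂ 4) bW.incl), (gC.IsRiemannian ∧ (∀ x, 0 < gC.scalarCurvature x) ∧ gC.IsUnitNormal (𝓡 3) bC.incl νC 1 ∧ ContMDiff (𝓡 3) (𝓡∂ 4).tangent ∞ (fun z ↦ (Bundle.TotalSpace.mk' (EuclideanSpace ℝ (Fin 4)) (bC.incl z) (νC z) : TangentBundle (𝓡∂ 4) C)) ∧ (∀ z, (show EuclideanSpace ℝ (Fin 4) from νC z) 0 < 0)) → (gW.IsRiemannian ∧ (∀ x, 0 < gW.scalarCurvature x) ∧ gW.IsUnitNormal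 (𝓡 3) bW.incl νW 1 ∧ ContMDiff (𝓡 3) (𝓡∂ 4).tangent ∞ (fun w ↦ (Bundle.TotalSpace.mk' (EuclideanSpace ℝ (Fin 4)) (bW.incl w) (νW w) : TangentBundle (𝓡∂ 4) W)) ∧ (∀ w, (show EuclideanSpace ℝ (Fin 4) from νW w) 0 < 0)) → (∀ z, Literature.Geometry.Lorentzian.pullbackBilin (I := 𝓡∂ 4) (I' := 𝓡 3) bC.incl gC.val z = Literature.Geometry.Lorentzian.pullbackBilin (I := 𝓡∂ 4) (I' := 𝓡 3) (bW.incl ∘ φ) gW.val z) → (∀ z, Literature.Geometry.Lorentzian.pullbackBilin (I := 𝓡∂ 4) (I' := 𝓡 3) bC.incl gC.val z = Literature.Geometry.Lorentzian.pullbackBilin (I := 𝓡∂ 4) (I' := 𝓡 3) (bW.incl ∘ φ ∘ τ) gW.val z) → (∀ z, 0 ≤ gC.meanCurvature bC.incl Literature.Geometry.Lorentzian.PseudoRiemannianMetric.contMDiff_pullbackBilin_holds hfC νC z + gW.meanCurvature bW.incl Literature.Geometry.Lorentzian.PseudoRiemannianMetric.contMDiff_pullbackBilin_holds hfW νW (φ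 z)) → (∀ z, 0 ≤ gC.meanCurvature bC.incl Literature.Geometry.Lorentzian.PseudoRiemannianMetric.contMDiff_pullbackBilin_holds hfC νC z + gW.meanCurvature bW.incl Literature.Geometry.Lorentzian.PseudoRiemannianMetric.contMDiff_pullbackBilin_holds hfW νW (φ (τ z))) → ∃ (P : Type) (_ : TopologicalSpace P) (_ : T2Space P) (_ : SecondCountableTopology P) (_ : ChartedSpace (EuclideanSpace ℝ (Fin 4)) P) (_ : IsManifold (𝓡 4) ∞ P), ∃ (jC : C → P) (jW : W → P), (Manifold.IsSmoothEmbedding (𝓡∂ 4) (𝓡 4) ∞ jC ∧ Manifold.IsSmoothEmbedding (𝓡∂ 4) (𝓡 4) ∞ jW ∧ Set.range jC ∪ Set.range jW = Set.univ ∧ (∀ a b, jC a = jW b ↔ ∃ z, a = bC.incl z ∧ b = bW.incl (φ z))) ∧ ∃ (g : Literature.Geometry.Lorentzian.PseudoRiemannianMetric (𝓡 4) ∞ (EuclideanSpace ℝ (Fin 4)) (TangentSpace (𝓡 4) : P → Type _)) (U : Set P) (T : P → P), g.IsRiemannian ∧ (∃ _ : g.HasLeviCivita, ∀ x, 0 <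 g.scalarCurvature x) ∧ IsOpen U ∧ (∀ z, jC (bC.incl z) ∈ U) ∧ ContMDiffOn (𝓡 4) (𝓡 4) ∞ T U ∧ (∀ x ∈ U, T x ∈ U) ∧ (∀ x ∈ U, T (T x) = x) ∧ (∀ x ∈ U, (T x ∈ Set.range jC ↔ x ∈ Set.range jC)) ∧ (∀ z, T (jC (bC.incl z)) = jC (bC.incl (τ z))) ∧ (∀ x ∈ U, Literature.Geometry.Lorentzian.pullbackBilin (I := 𝓡 4) (I' := 𝓡 4) T g.val x = g.val x) :=
  fun h28 h27 ↦ stub_symmetricGluingOfBHData_of_facts h28 h27 stub_collarGluing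

end Summit.SmoothPoincare4.SmoothPoincare4.Theorems

end
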